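import Literature.Analysis.FluidPDE.PalasekObukhov.TowerEnvelope
import HarnessLib

/-!
# Palasek 2026, §3.2: the INVISCID blow-up (Theorem 1.8) and the inviscid tower with constants

S. Palasek, *Finite-time blow-up in an elementary model of the 3D Navier–Stokes equations*,
arXiv:2605.13827 (May 2026) [`Palasek2026ElementaryModel`], §1.2 Theorem 1.8 and §3.2 (Prop. 3.3 and
the proof of Thm. 1.8, p. 9–10). Page numbers = arXiv-PDF pages (cell renders
`pub/ns-blowup/renders/paper-arxiv-2605.13827/p0004, p0008–p0010`).

The sibling files type and PROVE the VISCOUS theorem (Thm. 1.3 = `Palasek2026_viscousBlowup`,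
discharged by `Palasek2026_viscousBlowup_holds` in `PalasekObukhovBlowupProof.lean`) and the §3.3 tower
in tower coordinates (`IsTowerSolution`, `exists_isTowerSolution` in `PalasekObukhov/TowerEnvelope.lean`).
Both carry the VISCOUS parameter regime (viscous_A_assumptions) `b ∈ (1, α/2)`, `max{2b, α-s} < β < α`
— the clause `β > 2b` is the viscous absorption `νN_k² ≤ ¼A_{k-1}` of the proof of Prop. 3.4 and is
what forces `α > 2`. The statement file `PalasekObukhovBlowup.lean` records under "What is NOT here":
"Theorem 1.8 (inviscid, unforced blow-up for `α ≥ 1`)". This file supplies it, with proof, together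
with the inviscid tower for EVERY `0 < β < α` (no `β > 2b`; in particular the window `β ≤ 2`).

## What the source prints

* **Theorem 1.8 (Inviscid blow-up)** (§1.2, p. 4). "Let `ν = 0`, `α ≥ 1`, and `N_k` as in (nk_choice).
  There exists positive initial data `X⁰ ∈ 𝒞^∞` that gives rise to a finite-time blow-up of
  (l2_obukhov) with `f = 0`. In particular, for any `s > 0`, the data can be chosen so that `X` becomes
  unbounded in `𝒞^s`." (nk_choice): `N_k = N₀^{b^k}` "for some `N₀ > 1` and `b > 1` to be specified in
  the course of the proofs in §3"; Def. 1.2: finite-time blow-up means `T_* < ∞`.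
* **§3.1 (inviscid_A_assumptions)** (p. 8): "`A_k = N_k^β` … where `b` and `β` are chosen to satisfy
  `b > 1`, `max{0, α-s} < β < α` if `ν = 0`" (and `b ∈ (1, α/2)`, `max{2b, α-s} < β < α` if `ν > 0`);
  "We also fix a small constant `c > 0`", `T ≔ c/A₀`, `t₁ ≔ t₂ ≔ -T`, `t_k ≔ -cA_{k-2}^{-1}` (`k ≥ 3`);
  (exp_small)/(ratios) "for `N₀ > 1` large".
* **Proposition 3.3** (§3.2, p. 9): for the Galerkin truncation (truncated_inviscid)
  `x_k' = x_{k-1}x_k - δ_k x_{k+1}² 𝟙_{k ≤ K-1}` (`0 ≤ k ≤ K`) with terminal data `x_k^K(0) = A_k` there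
  is a unique solution in `C¹([-T,0]; ℝ^{K+1})`, and (uniform_truncated_bounds)
  `0 ≤ x_k^K(t) ≤ 2A_k exp(½A_{k-1}max{t,t_k})` (`1 ≤ k ≤ K`), `0 ≤ x₀^K(t) ≤ 2A₀`. Proof: the truncated
  energy `e_K = Σ ½N_k^{-2α}(x_k^K)²` is conserved (`e_K' = 0` by `δ_kN_k^{-2α} = N_{k+1}^{-2α}`), and the
  backward solution stays in the trapping region `ℛ_K(t)` of Def. 3.1 (first-exit argument with the two
  face inequalities; the case `t < t_k` uses (ratios) and (exp_small)).
* **Proof of Theorem 1.8** (p. 10): `‖x_k^K‖_{C¹} ≲_k 1` uniformly in `K`, bootstrap to `C²`, diagonal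
  Arzelà–Ascoli, locality in `k` ⇒ a limit solving (x_system_nondimensionalized) with `x_k(0) = A_k`
  for all `k`; "`‖X(0)‖_{𝒞^s} = sup_k N_k^{β-α+s} = ∞` due to the assumption `β > -s+α`"; (final_bounds)
  `0 ≤ X_k(t) ≤ 2A_kN_k^{-α}exp(½A_{k-1}max{t,t_k})`; "`X(t) ∈ 𝒞^∞` for `t ∈ [-T,0)`" by (final_bounds)
  and (exp_small): "`sup_{k>k_*} N_k^σ|X_k| ≲ sup_{k>k_*} A_kN_k^{σ-α}exp(-(c/2)A_{k-1}/A_{k-2}) < ∞`".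

## How this file follows the printed proof (and where it reuses the tree)

The tree's proof of Thm. 1.3 was written for an ABSTRACT viscosity profile: `BarrierHypotheses A δ μ₀ c`
is the bundle of standing inequalities of §3.1 with `μ₀ = νN₀² ≥ 0` ("`μ = 0` in the inviscid case",
`PalasekObukhovBarriers.lean`), `exists_trapped_solution` is Prop. 3.4 for viscous coefficients
`0 ≤ visc_k ≤ ¼A_{k-1}` — which at `visc ≡ 0` IS Prop. 3.3 (its docstring: "Prop. 3.3 for `visc ≡ 0`,
`μ₀ = 0`") — and `exists_regular_solution` is the `K → ∞` limit plus the `C^∞` bootstrap for `ν ≥ 0`.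
Hence the inviscid theorem needs exactly two new ingredients, both printed in §3.1/§3.2:
1. `barrierHypotheses_exp_inviscid`: the standing inequalities for `N₀ = e^L` large under the
   INVISCID regime `1 < b`, `0 < β < α`, `μ₀ = 0` (the viscous version `barrierHypotheses_exp` demands
   `2b < β` only for V1 with `ν > 0` and for the viscous absorption; at `μ₀ = 0`, V1 reads `e⁰ ≤ 3/2`);
2. `inviscidBlowup_of_hypotheses`: the assembly of p. 10 at `ν = 0` — the rescaled, time-shifted
   regular solution `X_k(t) = N_k^{-α}x_k(t-T)` (`physAmp`) solves (l2_obukhov) with `ν = 0` and the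
   force `physForce 0 ≡ 0` (`physForce_inviscid`), its datum is positive (`physData_pos`) and smooth
   ((hX)), it is bounded in every `𝒞^σ` on `[0, T']`, `T' < T` ((hX) with `d = T - T'`), and
   `‖X(t)‖_s → ∞` (`blowup_witness` + (hblow)).
The discharge `Palasek2026_inviscidBlowup_holds` takes `b = 2`, `β = (max{0, α-s} + α)/2`, `c = 1/10`,
`N₀ = e^L`, `L ≥ max{L₀, 1}` — "to be specified in the course of the proofs". In tower coordinates
(`amp`, `delta`, `horizon`, `tAct` of `PalasekObukhovParams.lean`) the same two steps give
`barrierHypotheses_amp_inviscid` and `exists_isTowerSolution_inviscid`: for `1 < b`, `0 < β < α` and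
every base `N₀ ≥ N_*`, a tower solution `IsTowerSolution 0 α N₀ b β (1/10) x` — the §3.2 construction
WITH ITS CONSTANTS (terminal profile `x_k(0) = A_k`, envelope (uniform_truncated_bounds), floors `¾A_k` on
`[t_{k+1}, 0]` and `A_ke^{-5A_{k-1}/A_{k-2}}`, smoothness), solving the UNFORCED inviscid system
(`IsTowerSolution.hasDeriv_inviscid`, `IsTowerSolution.forceTerm_inviscid`).

## Rendering (same conventions as `Palasek2026_viscousBlowup`)

Time is translated so that the datum sits at `t = 0` and the blow-up time is `T > 0`; sequences are
`ℕ → ℝ`; `X ∈ ⋂_{s>0} C_t([0,T); 𝒞^s)` solving (l2_obukhov) with `ν = 0`, `f = 0` is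
`IsSolutionOn 0 α N (fun _ _ => 0) X⁰ X T`; "X becomes unbounded in `𝒞^s`" is
`∀ M, ∃ t < T, ∃ k, M < N_k^s|X_k(t)|`, so `T` is the maximal time `T_*` of the local theory (which is not
formalised; Def. 1.2's `T_* < ∞` needs no separate clause); `N₀, b` are chosen after `α, s`.
The hypothesis `α ≥ 1` is carried as printed; the proof uses only `α > max{0, α - s}`, i.e. it runs for
every `α > 0` (`inviscidBlowup_of_hypotheses` is stated for arbitrary `α`).

## What is NOT here

Uniqueness in Prop. 3.3 (not used downstream; the tree's Prop. 3.4 rendering is existence + trapping),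
the local well-posedness theory and Rem. 1.10 (instability of the blow-up; its truncated-system
mechanism is `truncated_support_stable` in `TowerEnvelope.lean`), and any Euler/Navier–Stokes statement:
this is a theorem about an ODE shell model ("We also treat the inviscid, unforced case and obtain
singularity formation just above the energy level", abstract). No new named fact is left unproved:
`Palasek2026_inviscidBlowup` is discharged in this file.
-/

open Set Filter Topology
open scoped ContDiff

namespace Literature.Analysis.FluidPDE

namespace PalasekObukhov

/-! ### §3.1 (inviscid_A_assumptions): the standing inequalities for `N₀ = e^L` large, `μ₀ = 0` -/

section Param

variable {b β α : ℝ}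

/-- **The standing inequalities of §3.1 in the INVISCID regime, for `N₀ = e^L` large.** For `1 < b`
and `0 < β < α` there is `L₀ > 0` such that for all `L ≥ L₀` the data `A_k = e^{βb^kL}` (`= N_k^β`,
`N₀ = e^L`), `δ_k = (N_k/N_{k+1})^{2α}`, `μ₀ = 0` (no viscosity), `c = 1/10` satisfy the tree's bundle
`BarrierHypotheses` (the finitely many consequences of (exp_small)/(ratios) invoked by Lemma 3.2 and
Prop. 3.3), `δ_k ≤ 1`, and the monotonicity of `A_{k+1}/A_k`. Compared with the viscous
`barrierHypotheses_exp` the clause `2b < β` is gone: it served only V1 for `ν > 0` (here `e⁰ ≤ 3/2`) and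
the viscous absorption `νN_k² ≤ ¼A_{k-1}` (void at `ν = 0`).
[cite: Palasek2026ElementaryModel, §3.1 (inviscid_A_assumptions), (exp_small), (ratios); Lemma 3.2; §3.2 Prop. 3.3] -/
theorem barrierHypotheses_exp_inviscid (hb : 1 < b) (hβ : 0 < β) (hβα : β < α) :
    ∃ L₀ : ℝ, 0 < L₀ ∧ ∀ L, L₀ ≤ L →
      BarrierHypotheses (expAmp b β L) (expDelta b α L) 0 (1 / 10) ∧
      (∀ k, expDelta b α L k ≤ 1) ∧
      (∀ k, expAmp b β L (k + 1) / expAmp b β L k ≤ expAmp b β L (k + 2) / expAmp b β L (k + 1)) := by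
  have hb1 : 1 ≤ b := hb.le
  have hq : 0 < b - 1 := by linarith
  have hβ0 : 0 ≤ β := hβ.le
  have hα0 : 0 ≤ α := by linarith
  have hαβ : 0 < α - β := by linarith
  -- the four largeness conditions (V2/S2, S1/S4, E1, S4)
  obtain ⟨y₂, _, hy₂⟩ := exists_affine_le_mul_exp 0 16 one_pos
    (show 0 < 2 * (b - 1) * (α - β) by positivity)
  obtain ⟨y₄, _, hy₄⟩ := exists_mul_exp_le_exp_exp (show (0 : ℝ) < 4 by norm_num) (2 * β * b ^ 2)
    (show (0 : ℝ) < 1 / 20 by norm_num) (show 0 < β * (b - 1) by positivity)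
  obtain ⟨y₅, _, hy₅⟩ := exists_mul_exp_le_exp_exp (show (0 : ℝ) < 1 / 5 by norm_num) (β * b)
    (show (0 : ℝ) < 1 / 20 by norm_num) (show 0 < β * (b - 1) by positivity)
  obtain ⟨y₆, _, hy₆⟩ := exists_affine_le_mul_exp 0 101 one_pos
    (show 0 < β * (b - 1) ^ 2 by positivity)
  set L₀ := max 1 (max (max y₂ y₄) (max y₅ y₆)) with hL₀
  refine ⟨L₀, lt_of_lt_of_le one_pos (le_max_left _ _), fun L hL => ?_⟩
  have hL1 : 1 ≤ L := (le_max_left _ _).trans hL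
  have hL0 : 0 < L := one_pos.trans_le hL1
  have hLy₂ : y₂ ≤ L := le_trans (by simp [hL₀]) hL
  have hLy₄ : y₄ ≤ L := le_trans (by simp [hL₀]) hL
  have hLy₅ : y₅ ≤ L := le_trans (by simp [hL₀]) hL
  have hLy₆ : y₆ ≤ L := le_trans (by simp [hL₀]) hL
  have hyk : ∀ n : ℕ, L ≤ b ^ n * L := le_pow_mul hb1 hL0.le
  -- clean the `0 * y +` and `1 *` in the affine conditions
  simp only [zero_mul, zero_add, one_mul] at hy₂ hy₆
  refine ⟨⟨expAmp_pos b β L, expAmp_mono hb1 hβ0 hL0.le, fun k => ?_, by norm_num, ?_, le_rfl, ?_,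
    ?_, ?_, ?_, ?_, ?_⟩, expDelta_le_one hb1 hα0 hL0.le, ?_⟩
  · rw [expDelta_eq]; exact (Real.exp_pos _).le
  · have := Real.add_one_le_exp (-(2 * (1 / 10 : ℝ)))
    linarith
  · -- V1 at `μ₀ = 0`: `e⁰ ≤ 3/2`
    rw [zero_mul, Real.exp_zero]
    norm_num
  · exact V2_exp (hy₂ L hLy₂)
  · exact fun k hk => S1_exp hb1 hβ0 hL0 hα0 hk (hy₄ _ (hLy₄.trans (hyk _)))
  · exact fun k _ => S2_exp k (hy₂ _ (hLy₂.trans (hyk _)))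
  · exact fun j hj => E1_exp hb1 hβ0 hL0.le hj (hy₅ _ (hLy₅.trans (hyk _)))
  · exact fun k hk => S4_exp hb1 hβ0 hL0 hα0 hk (hy₄ _ (hLy₄.trans (hyk _)))
      (hy₆ _ (hLy₆.trans (hyk _)))
  · intro k
    have := expAmp_ratio_step hb1 hβ0 hL0.le (k + 2) (by omega)
    simpa using this

end Param

/-! ### §3.2, proof of Theorem 1.8 (p. 10): the assembly at `ν = 0` -/

section Assembly

variable {α s N₀ b c : ℝ} {N A δ : ℕ → ℝ} {x : ℝ → ℕ → ℝ}

/-- **At `ν = 0` the physical force vanishes identically**: `f_k = N_k^{-α}g_k`,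
`g_k = (1 - ρ_k)νN_k²x_k = 0` ("with `f = 0`"). [cite: Palasek2026ElementaryModel, §1.2 Thm 1.8 ("with f = 0"); §3.3 ("g_k ≔ N_k^α f_k")] -/
@[simp] theorem physForce_inviscid (α : ℝ) (N A : ℕ → ℝ) (c : ℝ) (x : ℝ → ℕ → ℝ) (k : ℕ) (t : ℝ) :
    physForce 0 α N A c x k t = 0 := by
  unfold physForce forceTerm viscCoeff
  split_ifs <;> simp

/-- **Palasek 2026, Theorem 1.8 — the assembly at `ν = 0`, modulo the parameter asymptotics.**
For scales `N_k = N₀^{b^k}` (`N₀, b > 1`) and amplitude data satisfying the standing inequalities of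
§3.1 with `μ₀ = 0` (`BarrierHypotheses A δ 0 c`, `δ_k = (N_k/N_{k+1})^{2α}`) together with the two
consequences of (exp_small) used on p. 10 — (hX) the weighted amplitude bounds
`N_k^{σ-α}·2A_k e^{½A_{k-1}max{-d,t_k}}` are bounded in `k` for every `σ` and `d > 0` ("`X(t) ∈ 𝒞^∞` for
`t ∈ [-T,0)`"), (hblow) `A_k N_k^{s-α}` is unbounded ("`sup_k N_k^{β-α+s} = ∞`") — there exist a positive
datum `X⁰ ∈ 𝒞^∞`, `T > 0` and a solution of the UNFORCED inviscid model (l2_obukhov) (`ν = 0`, `f = 0`)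
on `[0, T)` in `⋂_σ C_t([0,T); 𝒞^σ)` with `sup_{t<T} ‖X(t)‖_s = ∞`. The solution is Prop. 3.3 for every
truncation order, the `K → ∞` limit and the `C^∞` bootstrap — the tree's `exists_regular_solution` at
`ν = 0` — rescaled by `X_k = N_k^{-α}x_k` and shifted by `T`.
[cite: Palasek2026ElementaryModel, §1.2 Thm 1.8; §3.2 Prop. 3.3 and proof of Thm 1.8 (p. 10)] -/
theorem inviscidBlowup_of_hypotheses (hN₀ : 1 < N₀) (hH : BarrierHypotheses A δ 0 c)
    (hδ : ∀ k, δ k = (scale N₀ b k / scale N₀ b (k + 1)) ^ (2 * α))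
    (hX : ∀ σ d : ℝ, 0 < d → ∃ C, ∀ k, 1 ≤ k →
      scale N₀ b k ^ (σ - α) * (2 * A k) * Real.exp (A (k - 1) / 2 * max (-d) (tk A c k)) ≤ C)
    (hblow : ∀ M : ℝ, ∃ k, 1 ≤ k ∧ M < 3 / 4 * A k * scale N₀ b k ^ (s - α)) :
    ∃ (X0 : ℕ → ℝ) (X : ℕ → ℝ → ℝ) (T : ℝ), 0 < T ∧
      (∀ k, 0 < X0 k) ∧ MemSmooth (scale N₀ b) X0 ∧
      IsSolutionOn 0 α (scale N₀ b) (fun _ _ => 0) X0 X T ∧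
      ∀ M : ℝ, ∃ t ∈ Ico 0 T, ∃ k : ℕ, M < scale N₀ b k ^ s * |X k t| := by
  set N : ℕ → ℝ := scale N₀ b with hNdef
  have hN : ∀ j, 0 < N j := fun j => scale_pos (by linarith) b j
  have hT := hH.blowupT_pos
  set T := blowupT A c with hTdef
  -- Prop. 3.3 for every `K`, the limit `K → ∞` and the `C^∞` bootstrap, at `ν = 0`
  obtain ⟨x, hx0, hode, hb0, hbd, h34, hglob, hsm⟩ :=
    exists_regular_solution (ν := 0) (N := N) hH le_rfl (by rw [zero_mul])
      (fun k _ => by rw [zero_mul]; linarith [hH.A_pos (k - 1)])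
  have hsp : ∀ (k : ℕ) (σ : ℝ), N k ^ σ * N k ^ (-α) = N k ^ (σ - α) := fun k σ => by
    rw [← Real.rpow_add (hN k)]
    ring_nf
  refine ⟨physData α N A c x, physAmp α N A c x, T, hT, physData_pos hH hN hb0 h34 hglob, ?_, ?_, ?_⟩
  · -- `X⁰ ∈ 𝒞^∞` ("X(t) ∈ 𝒞^∞ for t ∈ [-T,0)", at `t = -T`)
    intro σ _
    obtain ⟨C, hC⟩ := hX σ T hT
    refine ⟨max C (N 0 ^ (σ - α) * (2 * A 0)), fun k => ?_⟩
    have h0T : (0 : ℝ) ∈ Icc 0 T := ⟨le_rfl, hT.le⟩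
    obtain ⟨hz, hpos⟩ := physAmp_bounds (α := α) (x := x) hN hb0 hbd h0T
    rw [← physAmp_zero_eq]
    rcases Nat.eq_zero_or_pos k with rfl | hk
    · rw [abs_of_nonneg ((mul_pos (hH.A_pos 0) (Real.rpow_pos_of_pos (hN 0) _)).le.trans hz.1)]
      refine le_trans ?_ (le_max_right _ _)
      have := mul_le_mul_of_nonneg_left hz.2 (Real.rpow_pos_of_pos (hN 0) σ).le
      calc N 0 ^ σ * physAmp α N A c x 0 0 ≤ N 0 ^ σ * (2 * A 0 * N 0 ^ (-α)) := this
        _ = N 0 ^ (σ - α) * (2 * A 0) := by rw [← hsp]; ring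
    · obtain ⟨h1, h2⟩ := hpos k hk
      rw [abs_of_nonneg h1]
      refine le_trans ?_ (le_max_left _ _)
      refine le_trans ?_ (hC k hk)
      have := mul_le_mul_of_nonneg_left h2 (Real.rpow_pos_of_pos (hN k) σ).le
      refine this.trans (le_of_eq ?_)
      rw [zero_sub, ← hsp]
      ring
  · -- the solution of the unforced inviscid model on `[0, T)`
    refine ⟨fun k => physAmp_zero_eq α N A c x k, fun k t ht => ?_, fun σ T' _ hT'T => ?_⟩
    · -- (l2_obukhov) with `ν = 0`, `f_k = physForce 0 = 0`
      have h := hasDerivWithinAt_physAmp (α := α) hN hδ hode k ht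
      rwa [physForce_inviscid] at h
    · -- bounded in every `𝒞^σ` on `[0, T']`, `T' < T` ((final_bounds) + (hX) with `d = T - T'`)
      have hd : 0 < T - T' := by linarith
      obtain ⟨C, hC⟩ := hX σ (T - T') hd
      refine ⟨max C (N 0 ^ (σ - α) * (2 * A 0)), fun t ht k => ?_⟩
      have htT : t ∈ Icc 0 T := ⟨ht.1, by linarith [ht.2]⟩
      obtain ⟨hz, hpos⟩ := physAmp_bounds (α := α) (x := x) hN hb0 hbd htT
      have hσ := (Real.rpow_pos_of_pos (hN k) σ).le
      rcases Nat.eq_zero_or_pos k with rfl | hk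
      · rw [abs_of_nonneg ((mul_pos (hH.A_pos 0) (Real.rpow_pos_of_pos (hN 0) _)).le.trans hz.1)]
        refine le_trans ?_ (le_max_right _ _)
        calc N 0 ^ σ * physAmp α N A c x 0 t ≤ N 0 ^ σ * (2 * A 0 * N 0 ^ (-α)) :=
              mul_le_mul_of_nonneg_left hz.2 hσ
          _ = N 0 ^ (σ - α) * (2 * A 0) := by rw [← hsp]; ring
      · obtain ⟨h1, h2⟩ := hpos k hk
        rw [abs_of_nonneg h1]
        refine le_trans ?_ ((hC k hk).trans (le_max_left _ _))
        have hmax : max (t - T) (tk A c k) ≤ max (-(T - T')) (tk A c k) :=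
          max_le_max (by linarith [ht.2]) le_rfl
        have hexp : Real.exp (A (k - 1) / 2 * max (t - T) (tk A c k)) ≤
            Real.exp (A (k - 1) / 2 * max (-(T - T')) (tk A c k)) :=
          Real.exp_le_exp.2 (mul_le_mul_of_nonneg_left hmax (by linarith [hH.A_pos (k - 1)]))
        have hA := (hH.A_pos k).le
        have hp := (Real.rpow_pos_of_pos (hN k) (-α)).le
        calc N k ^ σ * physAmp α N A c x k t
            ≤ N k ^ σ * (2 * A k * N k ^ (-α) * Real.exp (A (k - 1) / 2 * max (t - T) (tk A c k))) :=
              mul_le_mul_of_nonneg_left h2 hσ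
          _ ≤ N k ^ σ * (2 * A k * N k ^ (-α) *
                Real.exp (A (k - 1) / 2 * max (-(T - T')) (tk A c k))) := by
              refine mul_le_mul_of_nonneg_left (mul_le_mul_of_nonneg_left hexp ?_) hσ
              positivity
          _ = N k ^ (σ - α) * (2 * A k) * Real.exp (A (k - 1) / 2 * max (-(T - T')) (tk A c k)) := by
              rw [← hsp]; ring
  · -- blow-up at `T`: `N_k^s X_k(t) ≥ ¾A_kN_k^{s-α}` on `[T + t_{k+1}/2, T)` and (hblow)
    intro M
    obtain ⟨k, hk, hM⟩ := hblow M
    have htk := hH.tk_neg (k + 1)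
    have htkT := hH.neg_blowupT_le_tk (k + 1)
    refine ⟨T + tk A c (k + 1) / 2, ⟨by linarith, by linarith⟩, k, hM.trans_le ?_⟩
    exact blowup_witness hH hN h34 hk s ⟨by linarith, by linarith⟩

end Assembly

/-! ### Theorem 1.8 as a named statement, and its discharge -/

/-- **Palasek 2026, Theorem 1.8 (inviscid blow-up of the unforced super-lacunary Obukhov model)**, as
printed (module docstring) and rendered there: for every intermittency parameter `α ≥ 1` and every
`s > 0` there are scales `N_k = N₀^{b^k}` (`N₀ > 1`, `b > 1`, chosen in the proof), a positive datum
`X⁰ ∈ 𝒞^∞` and a time `0 < T < ∞` such that the INVISCID, UNFORCED model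
`X_k' = N_{k-1}^αX_{k-1}X_k - N_k^αX_{k+1}²` (`ν = 0`, `f = 0`, `X_{-1} ≡ 0`) has a solution on `[0, T)`
in the class `⋂_{σ>0} C_t([0,T); 𝒞^σ)` from `X⁰` which becomes unbounded in `𝒞^s` as `t ↑ T` (so `T`
is the blow-up time `T_* < ∞` of Def. 1.2). A theorem about an ODE shell model (the abstract:
"singularity formation just above the energy level", Rem. 1.7: unboundedness in `𝒞^s`, `s > 0`, is
sharp since `𝒞⁰` is controlled by the energy), not about Euler or Navier–Stokes. Named statement;
discharged below by `Palasek2026_inviscidBlowup_holds`.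
[cite: Palasek2026ElementaryModel, §1.2 Thm. 1.8, Def. 1.1–1.2; §3.1 (inviscid_A_assumptions); §3.2] -/
def Palasek2026_inviscidBlowup : Prop :=
  ∀ α s : ℝ, 1 ≤ α → 0 < s →
    ∃ N₀ b : ℝ, 1 < N₀ ∧ 1 < b ∧
      ∃ (X0 : ℕ → ℝ) (X : ℕ → ℝ → ℝ) (T : ℝ), 0 < T ∧
        (∀ k, 0 < X0 k) ∧ MemSmooth (scale N₀ b) X0 ∧
        IsSolutionOn 0 α (scale N₀ b) (fun _ _ => 0) X0 X T ∧
        ∀ M : ℝ, ∃ t ∈ Ico 0 T, ∃ k : ℕ, M < scale N₀ b k ^ s * |X k t|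

/-- Unpacking the blow-up clause: along the solution the weighted `s`-norm is not bounded on `[0, T)`
by any constant. [cite: Palasek2026ElementaryModel, §1.2 Thm. 1.8] -/
theorem Palasek2026_inviscidBlowup.not_memWeighted_uniform (h : Palasek2026_inviscidBlowup)
    {α s : ℝ} (hα : 1 ≤ α) (hs : 0 < s) :
    ∃ N₀ b : ℝ, 1 < N₀ ∧ 1 < b ∧ ∃ (X0 : ℕ → ℝ) (X : ℕ → ℝ → ℝ) (T : ℝ), 0 < T ∧
      IsSolutionOn 0 α (scale N₀ b) (fun _ _ => 0) X0 X T ∧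
      ¬ ∃ C : ℝ, ∀ t ∈ Ico 0 T, ∀ k, scale N₀ b k ^ s * |X k t| ≤ C := by
  obtain ⟨N₀, b, hN₀, hb, X0, X, T, hT, -, -, hsol, hblow⟩ := h α s hα hs
  refine ⟨N₀, b, hN₀, hb, X0, X, T, hT, hsol, ?_⟩
  rintro ⟨C, hC⟩
  obtain ⟨t, ht, k, hk⟩ := hblow C
  exact (lt_irrefl C) (hk.trans_le (hC t ht k))

/-- **Palasek 2026, Theorem 1.8 — the named statement `Palasek2026_inviscidBlowup` holds.**
Parameters (inviscid_A_assumptions): `b = 2 > 1`, `β = (max{0, α-s} + α)/2 ∈ (max{0, α-s}, α)`,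
`c = 1/10`, `N₀ = e^L` with `L` beyond the four largeness thresholds of `barrierHypotheses_exp_inviscid`;
then `inviscidBlowup_of_hypotheses` with the asymptotics `hX_exp`, `hblow_exp` of the tree. The proof
uses `α ≥ 1` only through `α > 0`. [cite: Palasek2026ElementaryModel, §1.2 Thm 1.8; §3.1 (inviscid_A_assumptions); §3.2 (proof, p. 10)] -/
theorem Palasek2026_inviscidBlowup_holds : Palasek2026_inviscidBlowup := by
  intro α s hα hs
  -- the exponents (inviscid_A_assumptions): `b > 1`, `max{0, α - s} < β < α`
  set b : ℝ := 2 with hb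
  have hb1 : 1 < b := by rw [hb]; norm_num
  set β : ℝ := (max 0 (α - s) + α) / 2 with hβ
  have hmax : max 0 (α - s) < α := max_lt (by linarith) (by linarith)
  have hβ0 : 0 < β := by
    have := le_max_left 0 (α - s)
    rw [hβ]; linarith
  have hβα : β < α := by rw [hβ]; linarith
  have hβs : 0 < β + s - α := by
    have := le_max_right 0 (α - s)
    rw [hβ]; linarith
  -- `N₀ = e^L` large
  obtain ⟨L₀, hL₀, hpar⟩ := barrierHypotheses_exp_inviscid (b := b) (β := β) (α := α) hb1 hβ0 hβα
  set L := max L₀ 1 with hL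
  have hLL₀ : L₀ ≤ L := le_max_left _ _
  have hLpos : 0 < L := lt_of_lt_of_le one_pos (le_max_right _ _)
  obtain ⟨hH, -, -⟩ := hpar L hLL₀
  refine ⟨Real.exp L, b, Real.one_lt_exp_iff.2 hLpos, hb1, ?_⟩
  exact inviscidBlowup_of_hypotheses (α := α) (s := s) (A := expAmp b β L) (δ := expDelta b α L)
    (c := 1 / 10) (Real.one_lt_exp_iff.2 hLpos) hH (fun k => rfl)
    (fun σ d hd => hX_exp hb1 hβ0 hLpos σ d hd) (fun M => hblow_exp hb1 hLpos hβs M)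

/-! ### §3.2 in tower coordinates: the inviscid tower with its constants, for every `0 < β < α` -/

section Tower

variable {b β α : ℝ}

/-- **(exp_small), (ratios) for `N₀` large in the INVISCID regime, tower coordinates.** For `1 < b`,
`0 < β < α` there is `N_* > 1` such that for every base `N₀ ≥ N_*` the schedule `A_k = N_k^β`,
`δ_k = (N_k/N_{k+1})^{2α}`, `μ₀ = 0`, `c = 1/10` satisfies `BarrierHypotheses`, `δ_k ≤ 1` and the
monotonicity of `A_{k+1}/A_k`. This is `barrierHypotheses_exp_inviscid` read at `L = log N₀`; no
`β > 2b`. [cite: Palasek2026ElementaryModel, §3.1 (inviscid_A_assumptions), (exp_small), (ratios)] -/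
theorem barrierHypotheses_amp_inviscid (hb : 1 < b) (hβ : 0 < β) (hβα : β < α) :
    ∃ Nstar : ℝ, 1 < Nstar ∧ ∀ N₀ : ℝ, Nstar ≤ N₀ →
      BarrierHypotheses (amp N₀ b β) (delta N₀ b α) 0 (1 / 10) ∧
      (∀ k, delta N₀ b α k ≤ 1) ∧
      (∀ k, amp N₀ b β (k + 1) / amp N₀ b β k ≤ amp N₀ b β (k + 2) / amp N₀ b β (k + 1)) := by
  obtain ⟨L₀, hL₀, hpar⟩ := barrierHypotheses_exp_inviscid (α := α) hb hβ hβα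
  refine ⟨Real.exp L₀, by simpa using hL₀, fun N₀ hN₀ => ?_⟩
  have hN₀pos : 0 < N₀ := lt_of_lt_of_le (Real.exp_pos L₀) hN₀
  have hL : L₀ ≤ Real.log N₀ := (Real.le_log_iff_exp_le hN₀pos).2 hN₀
  obtain ⟨hH, hδ1, hratio⟩ := hpar (Real.log N₀) hL
  have hA : expAmp b β (Real.log N₀) = amp N₀ b β := by
    funext k
    rw [amp_eq_exp hN₀pos]
    rfl
  have hδ : expDelta b α (Real.log N₀) = delta N₀ b α := by
    funext k
    simp only [expDelta, delta, Real.exp_log hN₀pos]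
  rw [hA, hδ] at hH
  rw [hδ] at hδ1
  rw [hA] at hratio
  exact ⟨hH, hδ1, hratio⟩

/-- **Existence of the INVISCID tower (Palasek §3.2) for every large base and every `0 < β < α`.**
For `1 < b`, `0 < β < α` there is `N_* > 1` such that for every `N₀ ≥ N_*` the schedule with `c = 1/10`
carries a tower solution at `ν = 0`: Prop. 3.3 for every truncation order, the `K → ∞` limit (p. 10)
and the `C^∞` bootstrap (the tree's `exists_regular_solution` at `ν = 0`, fed with
`barrierHypotheses_amp_inviscid`). All the envelope constants of `IsTowerSolution` hold: `x_k(0) = A_k`,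
`A₀ ≤ x₀ ≤ 2A₀`, `0 ≤ x_k ≤ 2A_ke^{½A_{k-1}max{t,t_k}}` ((uniform_truncated_bounds)), `x_k ≥ ¾A_k` on
`[t_{k+1}, 0]`, `x_k ≥ A_ke^{-5A_{k-1}/A_{k-2}}` (`k ≥ 2`). Unlike `exists_isTowerSolution` there is no
hypothesis `2b < β`: every `β ∈ (0, α)` is admissible, in particular `β ≤ 2`.
[cite: Palasek2026ElementaryModel, §3.2 Prop. 3.3 and proof of Thm 1.8 (p. 10); §3.1 (inviscid_A_assumptions)] -/
theorem exists_isTowerSolution_inviscid (hb : 1 < b) (hβ : 0 < β) (hβα : β < α) :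
    ∃ Nstar : ℝ, 1 < Nstar ∧ ∀ N₀ : ℝ, Nstar ≤ N₀ →
      ∃ x : ℝ → ℕ → ℝ, IsTowerSolution 0 α N₀ b β (1 / 10) x := by
  obtain ⟨Nstar, hNstar, hpar⟩ := barrierHypotheses_amp_inviscid (α := α) hb hβ hβα
  refine ⟨Nstar, hNstar, fun N₀ hN₀ => ?_⟩
  obtain ⟨hH, -, -⟩ := hpar N₀ hN₀
  have hN₀1 : 1 < N₀ := lt_of_lt_of_le hNstar hN₀
  obtain ⟨x, h0, hode, hb0, hbd, h34, hglob, hsm⟩ :=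
    exists_regular_solution (ν := 0) (N := scale N₀ b) (A := amp N₀ b β) (δ := delta N₀ b α)
      (μ0 := 0) (c := 1 / 10) hH le_rfl (by rw [zero_mul])
      (fun k _ => by rw [zero_mul]; linarith [hH.A_pos (k - 1)])
  exact ⟨x, hN₀1, hb.le, hβ.le, by norm_num, h0, hode, hsm, hb0, hbd, h34, hglob⟩

end Tower

namespace IsTowerSolution

variable {α N₀ b β c : ℝ} {x : ℝ → ℕ → ℝ}

/-- **At `ν = 0` the tower solves the UNFORCED inviscid system** (x_system_nondimensionalized with
`ν = 0`, `g = 0`; the limit of (truncated_inviscid)): `x_k' = x_{k-1}x_k - δ_kx_{k+1}²` (`x_{-1} ≡ 0`) on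
`[-T, 0]`. [cite: Palasek2026ElementaryModel, §3.2 (truncated_inviscid) and proof of Thm 1.8 ("the limit x_k obeys (x_system_nondimensionalized)")] -/
theorem hasDeriv_inviscid (h : IsTowerSolution 0 α N₀ b β c x) (k : ℕ) {t : ℝ}
    (ht : t ∈ Icc (-horizon N₀ b β c) 0) :
    HasDerivWithinAt (fun s => x s k)
      ((if k = 0 then 0 else x t (k - 1) * x t k) - delta N₀ b α k * x t (k + 1) ^ 2)
      (Icc (-horizon N₀ b β c) 0) t := by
  refine (h.hasDeriv k t ht).congr_deriv ?_
  simp [truncRHS, viscCoeff]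

/-- **The inviscid tower is unforced**: the force `g_k = (1-ρ_k)νN_k²x_k` of §3.3 vanishes at `ν = 0`
(Thm 1.8: "with `f = 0`"). [cite: Palasek2026ElementaryModel, §1.2 Thm 1.8; §3.3 ("g_k = (1-ρ_k)N_k²x_k")] -/
theorem forceTerm_inviscid (N A : ℕ → ℝ) (c : ℝ) (x : ℝ → ℕ → ℝ) (k : ℕ) (t : ℝ) :
    forceTerm 0 N A c x k t = 0 := by
  simp [forceTerm, viscCoeff]

/-- **Energy conservation along the inviscid tower** (proof of Prop. 3.3: "`e_K'(t) = 0`", in the limit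
`K → ∞` every finite partial sum evolves only through the boundary flux): with `visc ≡ 0` the truncated
energy `e_K(t) = Σ_{k≤K} ½N_k^{-2α}x_k²` of the tower has derivative `-N_{K+1}^{-2α}x_Kx_{K+1}²`
within `[-T, 0]` — the flux through the top of the window `k ≤ K`, and no dissipation term.
[cite: Palasek2026ElementaryModel, §3.2 proof of Prop. 3.3 (truncated energy, "e_K' = 0" via δ_kN_k^{-2α} = N_{k+1}^{-2α})] -/
theorem hasDerivWithinAt_shellEnergy_inviscid (h : IsTowerSolution 0 α N₀ b β c x) (K : ℕ) {t : ℝ}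
    (ht : t ∈ Icc (-horizon N₀ b β c) 0) :
    HasDerivWithinAt (fun s => shellEnergy (scale N₀ b) α K (x s))
      (-(scale N₀ b (K + 1) ^ (-(2 * α)) * x t K * x t (K + 1) ^ 2))
      (Icc (-horizon N₀ b β c) 0) t := by
  set N : ℕ → ℝ := scale N₀ b with hN
  set δ : ℕ → ℝ := delta N₀ b α with hδdef
  have hδ : ∀ k, δ k * N k ^ (-(2 * α)) = N (k + 1) ^ (-(2 * α)) :=
    fun k => delta_mul_scale_rpow_neg h.N₀_pos b α k
  have hode := fun k => h.hasDeriv_inviscid k ht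
  have hsum : HasDerivWithinAt (fun r => shellEnergy N α K (x r))
      (∑ k ∈ Finset.range (K + 1), 1 / 2 * N k ^ (-(2 * α)) *
        (2 * x t k * ((if k = 0 then 0 else x t (k - 1) * x t k) - δ k * x t (k + 1) ^ 2)))
      (Icc (-horizon N₀ b β c) 0) t := by
    unfold shellEnergy
    refine HasDerivWithinAt.fun_sum fun k _ => ?_
    have h2 : HasDerivWithinAt (fun r => x r k ^ 2)
        (2 * x t k * ((if k = 0 then 0 else x t (k - 1) * x t k) - δ k * x t (k + 1) ^ 2))
        (Icc (-horizon N₀ b β c) 0) t := by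
      simpa using (hode k).fun_pow 2
    exact h2.const_mul _
  have heq : ∑ k ∈ Finset.range (K + 1), 1 / 2 * N k ^ (-(2 * α)) *
        (2 * x t k * ((if k = 0 then 0 else x t (k - 1) * x t k) - δ k * x t (k + 1) ^ 2)) =
      -(N (K + 1) ^ (-(2 * α)) * x t K * x t (K + 1) ^ 2) := by
    rw [← sum_weighted_transfer_eq hδ (x t) K]
    refine Finset.sum_congr rfl fun k _ => ?_
    ring
  rw [heq] at hsum
  exact hsum

end IsTowerSolution

end PalasekObukhov

end Literature.Analysis.FluidPDE
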